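import Summits.Langlands.Langlands.Theses.EisensteinDegreeShift
import Literature.NumberTheory.GaloisRepresentations.ChebotarevCosetCyclotomic
import Literature.NumberTheory.GaloisRepresentations.FrobeniusGeneration
import Literature.NumberTheory.GaloisRepresentations.DecompositionGroupOfCompletion
import Literature.NumberTheory.GaloisRepresentations.ResidualRepresentation
import Literature.NumberTheory.GaloisRepresentations.ResidualGaloisRepOpenKernel
import Literature.NumberTheory.GaloisRepresentations.ModNCyclotomicCharacter
import Literature.NumberTheory.GaloisRepresentations.IntegralGaloisActionProofs
import HarnessLib

/-!
# Stub `stub_chebotarevUnipotentPlace` of line `birth`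
# (crux stmt-Langlands-18370 `EisensteinDegreeShift.EisensteinSteinbergSeed`)

Support file (closes nothing; `--supports stmt-Langlands-18370`).  The registered skeleton
`Cruxes/EisensteinSteinbergSeed/Lines/birth.lean` cuts the crux into three named stubs; this file
proves the FIRST one, the Chebotarev set-up step ("a level-raising place"), with exactly the
registered signature, in the namespace of the line.

**Statement.**  `K` a number field, `p` a prime, `O = ℤ̄_p` the valuation ring of `ℚ̄_p`,
`ρ : Γ_K → GL_n(ℚ̄_p)` almost everywhere unramified with an integral model
`ρ₀ : Γ_K → GL_n(O)` in the same frame, residually upper triangular.  Then there is a finite place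
`v₀ ∤ p` of `K`, unramified for `ρ`, with `N v₀ ≡ 1 (mod p)` and every residual diagonal entry
`χ̄_i = (ρ₀)_{ii} mod 𝔪_O` equal to `1` on the whole image of `Γ_{K_{v₀}} → Γ_K`
(`absGaloisRestrict K (v₀.adicCompletion K)`).

**Proof** (all inputs are proved theorems of the tree).
* `ρ̄ = ρ₀ mod 𝔪_O : Γ_K → GL_n(O/𝔪_O)` has open kernel (`isOpen_ker_residualRep` with
  `isOpen_setOf_mem_maximalIdeal_padicAlgClIntegers`: `𝔪_O` is the open unit ball of `ℚ̄_p` and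
  `ρ` is continuous), and so has the mod-`p` cyclotomic character `χ̄_p`
  (`modNCyclotomicCharacter_eventually_eq_one`); put `N = ker ρ̄ ∩ ker χ̄_p`, open and normal.
* Chebotarev, existence form (`infinite_setOf_prime_absNorm_frobenius_mul_inv_mem N 1`):
  infinitely many `v` with all inertia groups above `v` inside `N` and an arithmetic Frobenius
  `Φ ∈ N` at some prime `𝔓 ∣ v` of `ℤ̄_K`.  Discard the finitely many `v ∣ p`
  (`Ideal.finite_factors`) and the finitely many `v` at which `ρ` ramifies (the hypothesis
  `∀ᶠ v in cofinite, ρ.IsUnramifiedAt v`); pick `v₀` among the rest.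
* `χ̄_p(Φ) = N v₀ (mod p)` (`modNCyclotomicCharacter_eq_residueCard_of_isArithFrobAt`, `v₀ ∤ p`)
  and `χ̄_p(Φ) = 1` give `N v₀ ≡ 1 (mod p)`.
* The image of `Γ_{K_{v₀}}` is the decomposition group `D_{𝔓₀}` of the prime
  `𝔓₀ = adicCompletionPrime K v₀` above `v₀`
  (`decompositionSubgroup_adicCompletionPrime_eq_range`).  Conjugating `Φ` gives an arithmetic
  Frobenius `Φ₀ = τ Φ τ⁻¹ ∈ N` at `𝔓₀` (`exists_isArithFrobAt_conj_of_mem_primesAbove_holds`,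
  `N` normal), and `D_{𝔓₀} = ⟨Φ₀⟩ · I_{𝔓₀} · N`
  (`exists_eq_frobenius_pow_mul_of_mem_decompositionSubgroup`, `N` open) with `I_{𝔓₀} ≤ N`
  shows `D_{𝔓₀} ≤ N ≤ ker ρ̄`; on `ker ρ̄` every residual diagonal entry is `1`.

This is the "level-raising place" of Ribet / Diamond–Taylor (`q ≡ 1 (mod p)`, `ρ̄|_{D_{v₀}}`
unipotent up to semisimplification).

References: J. Neukirch, *Algebraic Number Theory* (1999), VII (13.4) (Chebotarev), I §9
[NeukirchANT1999]; F. Diamond, R. Taylor, Invent. Math. 115 (1994), Thm. A [DiamondTaylor1994];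
C. Skinner, A. Wiles, Publ. IHÉS 89 (1999), §1 [SkinnerWiles1999].
-/

noncomputable section

open scoped MatrixGroups NumberField
open Filter

-- `Summit.Langlands.Langlands.…`: summit = sub-problem name (D-0017 nested layout), not a typo.
set_option linter.dupNamespace false

namespace Summit.Langlands.Langlands.Cruxes.EisensteinSteinbergSeed.Birth

open Field IsDedekindDomain IsLocalRing Literature.NumberTheory.GaloisRepresentations

/-- **STUB 1 of line `birth` — `ChebotarevUnipotentPlace` (a level-raising place: `N v₀ ≡ 1 (mod p)`
and all residual diagonal characters trivial on the decomposition group at `v₀`).**  For any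
number field `K`, prime `p`, `O` the valuation ring of `ℚ̄_p`, `ρ : Γ_K → GL_n(ℚ̄_p)` a.e.
unramified with a residually upper-triangular integral model `ρ₀ : Γ_K → GL_n(O)` in the same
frame: there is a finite place `v₀ ∤ p` of `K`, unramified for `ρ`, with `N v₀ ≡ 1 (mod p)` and
`χ̄_i(σ) = 1` for every `σ` in the image of `Γ_{K_{v₀}} → Γ_K` and every `i`
(`χ̄_i = residualDiag ρ₀ i`).  Proof: Chebotarev (existence form, for the open normal subgroup
`ker (ρ₀ mod 𝔪_O) ∩ ker χ̄_p` and the trivial coset), the Frobenius/inertia generation of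
decomposition groups modulo open subgroups, and `D_{𝔓₀} = im Γ_{K_{v₀}}` for the prime `𝔓₀` of
the completion; see the module docstring.
[cite: NeukirchANT1999, VII (13.4)] [cite: DiamondTaylor1994, Thm A] [cite: SkinnerWiles1999, §1] -/
theorem stub_chebotarevUnipotentPlace :
    ∀ (K : Type) [Field K] [NumberField K] (n : ℕ) (p : ℕ) [Fact p.Prime] (O : ValuationSubring (PadicAlgCl p)), O = (Valued.v : Valuation (PadicAlgCl p) NNReal).valuationSubring → ∀ (ρ : Literature.NumberTheory.GaloisRepresentations.FramedGaloisRep K (PadicAlgCl p) n) (ρ₀ : Field.absoluteGaloisGroup K →* GL (Fin n) O), (∀ᶠ v : IsDedekindDomain.HeightOneSpectrum ((NumberField.RingOfIntegers K)) in Filter.cofinite, ρ.IsUnramifiedAt v) → ρ.HasUpperTriangularIntegralModel ρ₀ → ∃ v₀ : IsDedekindDomain.HeightOneSpectrum ((NumberField.RingOfIntegers K)), ((p : ℕ) : (NumberField.RingOfIntegers K)) ∉ v₀.asIdeal ∧ ρ.IsUnramifiedAt v₀ ∧ Nat.ModEq p v₀.residueCard 1 ∧ ∀ (σ : Field.absoluteGaloisGroup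 (v₀.adicCompletion K)) (i : Fin n), Literature.NumberTheory.GaloisRepresentations.residualDiag ρ₀ i (Literature.NumberTheory.GaloisRepresentations.absGaloisRestrict K (v₀.adicCompletion K) σ) = 1 := by
  intro K _ _ n p _ O hO ρ ρ₀ hae hut
  subst hO
  classical
  have hp : p.Prime := Fact.out
  haveI : NeZero (p : K) := ⟨Nat.cast_ne_zero.mpr hp.ne_zero⟩
  -- the residual representation `ρ̄ = ρ₀ mod 𝔪` and its open kernel
  set ρbar : absoluteGaloisGroup K →* GL (Fin n) (ResidueField (padicAlgClIntegers p)) :=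
    (Matrix.GeneralLinearGroup.map (residue (padicAlgClIntegers p))).comp ρ₀ with hρbar
  have hmodel : ∀ g, Matrix.GeneralLinearGroup.map (padicAlgClIntegers p).subtype (ρ₀ g) =
      (1 : GL (Fin n) (PadicAlgCl p))⁻¹ * ρ g * 1 := fun g => by
    rw [inv_one, one_mul, mul_one]
    exact hut.1 g
  have hρbar_open : IsOpen (ρbar.ker : Set (absoluteGaloisGroup K)) :=
    isOpen_ker_residualRep isOpen_setOf_mem_maximalIdeal_padicAlgClIntegers hmodel
  -- the mod `p` cyclotomic character and the open normal subgroup `N = ker ρ̄ ∩ ker χ̄_p`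
  set χ : absoluteGaloisGroup K →* (ZMod p)ˣ := modNCyclotomicCharacter K p with hχdef
  set N : Subgroup (absoluteGaloisGroup K) := (ρbar.prod χ).ker with hNdef
  haveI hNn : N.Normal := MonoidHom.normal_ker _
  have hNmem : ∀ γ : absoluteGaloisGroup K, γ ∈ N ↔ ρbar γ = 1 ∧ χ γ = 1 := fun γ => by
    rw [hNdef, MonoidHom.mem_ker, MonoidHom.prod_apply, Prod.mk_eq_one]
  have hχopen : IsOpen (χ.ker : Set (absoluteGaloisGroup K)) := by
    refine Subgroup.isOpen_of_mem_nhds χ.ker (g := 1) ?_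
    have h1 := modNCyclotomicCharacter_eventually_eq_one K p
    exact h1.mono fun γ hγ => (MonoidHom.mem_ker).mpr hγ
  have hN : IsOpen (N : Set (absoluteGaloisGroup K)) := by
    have hNeq : (N : Set (absoluteGaloisGroup K)) =
        (ρbar.ker : Set (absoluteGaloisGroup K)) ∩ (χ.ker : Set (absoluteGaloisGroup K)) := by
      ext γ
      simp only [SetLike.mem_coe, Set.mem_inter_iff, MonoidHom.mem_ker, hNmem]
    rw [hNeq]
    exact hρbar_open.inter hχopen
  -- the finitely many places above `p` and the finitely many ramified places
  have hfin₁ : {v : HeightOneSpectrum (𝓞 K) | ((p : ℕ) : 𝓞 K) ∈ v.asIdeal}.Finite := by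
    have h : Ideal.span {((p : ℕ) : 𝓞 K)} ≠ ⊥ := by
      rw [ne_eq, Ideal.span_singleton_eq_bot]
      exact_mod_cast hp.ne_zero
    refine (Ideal.finite_factors h).subset fun v hv => ?_
    exact Ideal.dvd_iff_le.mpr ((Ideal.span_singleton_le_iff_mem _).mpr hv)
  have hfin₂ : {v : HeightOneSpectrum (𝓞 K) | ¬ ρ.IsUnramifiedAt v}.Finite :=
    Filter.eventually_cofinite.mp hae
  -- Chebotarev: a good place `v₀` with inertia in `N` and a Frobenius `Φ ∈ N` above it
  obtain ⟨v₀, ⟨⟨-, hinertia, 𝔓, h𝔓, Φ, hΦ, hΦN⟩, hv₀p⟩, hv₀unr⟩ :=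
    (((infinite_setOf_prime_absNorm_frobenius_mul_inv_mem N hN 1).sdiff hfin₁).sdiff
      hfin₂).nonempty
  simp only [Set.mem_setOf_eq, not_not] at hv₀p hv₀unr
  rw [inv_one, mul_one] at hΦN
  obtain ⟨-, hχΦ⟩ := (hNmem Φ).mp hΦN
  refine ⟨v₀, hv₀p, hv₀unr, ?_, ?_⟩
  · -- `N v₀ ≡ 1 (mod p)`: `χ̄_p(Φ) = N v₀` and `χ̄_p(Φ) = 1`
    haveI : 𝔓.IsPrime := h𝔓.1
    have hp𝔓 : ((p : ℕ) : absIntegers (𝓞 K) K) ∉ 𝔓 := by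
      intro h
      apply hv₀p
      have h' : ((p : ℕ) : 𝓞 K) ∈ 𝔓.under (𝓞 K) := by
        rw [Ideal.under_def, Ideal.mem_comap, map_natCast]
        exact h
      rwa [← h𝔓.2.over] at h'
    have hval :=
      modNCyclotomicCharacter_eq_residueCard_of_isArithFrobAt (K := K) (N := p) h𝔓 hp𝔓 hΦ
    rw [← hχdef, hχΦ, Units.val_one] at hval
    have h1 : ((1 : ℕ) : ZMod p) = (v₀.residueCard : ZMod p) := by
      rw [Nat.cast_one]
      exact hval
    exact ((ZMod.natCast_eq_natCast_iff _ _ _).mp h1).symm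
  · -- the image of `Γ_{K_{v₀}}` is `D_{𝔓₀} ≤ N ≤ ker ρ̄`
    intro σ i
    have h𝔓₀ : adicCompletionPrime K v₀ ∈ v₀.primesAbove := adicCompletionPrime_mem_primesAbove K v₀
    have hg : absGaloisRestrict K (v₀.adicCompletion K) σ ∈
        (adicCompletionPrime K v₀).decompositionSubgroup (absoluteGaloisGroup K) := by
      rw [decompositionSubgroup_adicCompletionPrime_eq_range]
      exact ⟨σ, rfl⟩
    obtain ⟨τ, -, hΦ'⟩ :=
      HeightOneSpectrum.exists_isArithFrobAt_conj_of_mem_primesAbove_holds h𝔓 h𝔓₀ hΦ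
    obtain ⟨m, ι, u, hι, hu, hdec⟩ :=
      exists_eq_frobenius_pow_mul_of_mem_decompositionSubgroup h𝔓₀ hΦ' hN hg
    have hΦ'N : τ * Φ * τ⁻¹ ∈ N := hNn.conj_mem Φ hΦN τ
    have hmem : absGaloisRestrict K (v₀.adicCompletion K) σ ∈ N := by
      rw [hdec]
      exact N.mul_mem (N.mul_mem (N.pow_mem hΦ'N m)
        (hinertia (adicCompletionPrime K v₀) h𝔓₀ hι)) hu
    have h1 : ρbar (absGaloisRestrict K (v₀.adicCompletion K) σ) = 1 := ((hNmem _).mp hmem).1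
    have h2 : residualDiag ρ₀ i (absGaloisRestrict K (v₀.adicCompletion K) σ) =
        (ρbar (absGaloisRestrict K (v₀.adicCompletion K) σ)).val i i := rfl
    rw [h2, h1, Units.val_one, Matrix.one_apply_eq]

end Summit.Langlands.Langlands.Cruxes.EisensteinSteinbergSeed.Birth

end
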